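import Summits.BirchSwinnertonDyer.BirchSwinnertonDyer.Theses.MordellShaFreeCut
import Summits.BirchSwinnertonDyer.BirchSwinnertonDyer.Theorems.MordellShaFreeCutRungSupersingular
import Mathlib.NumberTheory.LSeries.PrimesInAP
import Literature.NumberTheory.EllipticCurves.BSDSelmerCMPConverse
import Literature.NumberTheory.EllipticCurves.BSDInvariantsProofs
import Literature.NumberTheory.EllipticCurves.GlobalMinimalModelProofs
import Literature.NumberTheory.EllipticCurves.LeadingTermBSZOrdinaryProofs
import Literature.NumberTheory.EllipticCurves.BSDQuadraticDescentShaOddPartGeneralProofs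

set_option linter.dupNamespace false
set_option autoImplicit false

/-! # Route `MordellShaFreeCut` (rung S2b) — crux `AnalyticRankOneOfRankOneFiniteShaThree`
(stmt-BirchSwinnertonDyer-19160): the crux with `#Ш[3^∞] < ∞` strengthened to `#Ш < ∞` is a
theorem modulo Burungale–Kobayashi–Ota 2024 Thm. 1.5

TIGHTNESS DATUM for the tribunal and the line `heegner-field-gz`. The crux reads
`rank E_D(ℚ) = 1 ∧ #Ш(E_D/ℚ)[3^∞] < ∞ ⟹ ord_{s=1} L(E_D, s) = 1` for the Mordell curves
`E_D : y² = x³ + D`. Replace the finiteness of the `3`-PRIMARY part of `Ш` by the finiteness of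
`Ш(E_D/ℚ)` itself (the Tate–Shafarevich conjecture for `E_D`, tree predicate
`WeierstrassCurve.ShaFinite`): then `Ш(E_D/ℚ)[p^∞]` is finite at EVERY prime, in particular at a
prime `p ≡ 2 (mod 3)`, `p ≥ 5`, `p ∤ D` — which exists by Dirichlet's theorem (Mathlib
`Nat.forall_exists_prime_gt_and_modEq`) — where `E_D` has GOOD SUPERSINGULAR reduction
(`a_p(E_D) = 0`, Ireland–Rosen Ch. 18 §3 Thm. 4; `p` inert in `ℚ(√−3)`), and the landed BC5 rung
`MordellShaFreeCutRungSupersingular.stub_rung_supersingular` (p410946: Burungale–Kobayashi–Ota,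
JIMJ 23 (2024) Thm. 1.5 specialised to `E_D`, REFEREED, carried as the named fact `hBKO`) returns
`ord_{s=1} L(E_D, s) = 1`. So, for integral globally minimal Mordell equations, the whole content
of the crux beyond refereed print is the restriction of its Ш-hypothesis to the `3`-primary part:
the one prime the hypothesis speaks about is the one prime (additive for `E_D`) at which no
`p`-converse is in refereed print. Stated for `D : ℤ` with `y² = x³ + D` globally minimal, the
generality of the rung (the tree's `a_p` is read on a global minimal model). Supports the item;
closes nothing; conditional on `hBKO` exactly as the rung is. -/

namespace Summit.BirchSwinnertonDyer.BirchSwinnertonDyer.Theorems.MordellShaFreeCutOfFiniteSha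

open Literature.NumberTheory.EllipticCurves WeierstrassCurve

/-- **A good supersingular prime for `E_D` avoiding `D`.** For every integer `D ≠ 0` there is a
prime `p ≥ 5` with `p ≡ 2 (mod 3)` and `p ∤ D` (Dirichlet's theorem on primes in the progression
`2 mod 3`, Mathlib `Nat.forall_exists_prime_gt_and_modEq`, applied above `max 4 |D|`). -/
theorem exists_prime_five_le_mod_three_eq_two_not_dvd {D : ℤ} (hD : D ≠ 0) :
    ∃ p : ℕ, p.Prime ∧ 5 ≤ p ∧ p % 3 = 2 ∧ ¬ (p : ℤ) ∣ D := by
  obtain ⟨p, hpgt, hpP, hpmod⟩ :=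
    Nat.forall_exists_prime_gt_and_modEq (max 4 D.natAbs) (q := 3) (a := 2) (by norm_num)
      (by norm_num)
  have h4 : 4 < p := lt_of_le_of_lt (le_max_left 4 D.natAbs) hpgt
  have hDp : D.natAbs < p := lt_of_le_of_lt (le_max_right 4 D.natAbs) hpgt
  refine ⟨p, hpP, by omega, ?_, ?_⟩
  · have h : p % 3 = 2 % 3 := hpmod
    simpa using h
  · intro h
    have h1 : p ∣ D.natAbs := Int.natCast_dvd.mp h
    have h2 : 0 < D.natAbs := Int.natAbs_pos.mpr hD
    exact absurd (Nat.le_of_dvd h2 h1) (by omega)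

/-- **Crux B with `Ш(E_D/ℚ)` finite in place of `Ш(E_D/ℚ)[3^∞]` finite, modulo BKO 2024
Thm. 1.5** (`hBKO`): for an integer `D ≠ 0` with `y² = x³ + D` globally minimal,
`rank E_D(ℚ) = 1 ∧ #Ш(E_D/ℚ) < ∞ ⟹ ord_{s=1} L(E_D, s) = 1`. Proof: pick a prime `p ≥ 5`,
`p ≡ 2 (mod 3)`, `p ∤ D` (`exists_prime_five_le_mod_three_eq_two_not_dvd`); `Ш(E_D/ℚ)[p^∞]`
is finite as a subgroup of the finite `Ш(E_D/ℚ)`; apply the rung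
`MordellShaFreeCutRungSupersingular.stub_rung_supersingular`. -/
theorem analyticRank_eq_one_of_mordellWeilRank_eq_one_of_shaFinite_of_bko
    (hBKO : BurungaleKobayashiOta2024.thm15_analyticRank_eq_one_of_selmerCorank_eq_one)
    {D : ℤ} (hD : D ≠ 0) [(mordellCurve (D : ℚ)).IsGloballyMinimal]
    (hrank : (mordellCurve (D : ℚ)).mordellWeilRank = 1)
    (hsha : (mordellCurve (D : ℚ)).ShaFinite) :
    (mordellCurve (D : ℚ)).analyticRank = 1 := by
  obtain ⟨p, hpP, hp5, hp3, hpD⟩ := exists_prime_five_le_mod_three_eq_two_not_dvd hD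
  haveI : Fact p.Prime := ⟨hpP⟩
  haveI : Finite (mordellCurve (D : ℚ)).sha := hsha
  exact MordellShaFreeCutRungSupersingular.stub_rung_supersingular hBKO hD hp5 hp3 hpD hrank
    inferInstance

/-- **The crux restricted to integral globally minimal equations, granted `Ш(E_D/ℚ)` finite
whenever `Ш(E_D/ℚ)[3^∞]` is, modulo BKO** — the shape that makes the comparison with the route
decl literal: if for the Mordell curves with `rank E_D(ℚ) = 1` finiteness of the `3`-primary part
propagated to all of `Ш` (`hprop`, an instance of the Tate–Shafarevich conjecture; NOT a theorem),
the integral globally-minimal slice of `AnalyticRankOneOfRankOneFiniteShaThree` would follow from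
the refereed BKO Thm. 1.5 alone. Recorded to pin WHERE the crux exceeds print, not as progress. -/
theorem analyticRank_eq_one_of_finite_sha_primary_three_of_propagation_of_bko
    (hBKO : BurungaleKobayashiOta2024.thm15_analyticRank_eq_one_of_selmerCorank_eq_one)
    (hprop : ∀ ⦃D : ℤ⦄, D ≠ 0 → (mordellCurve (D : ℚ)).mordellWeilRank = 1 →
      Finite (AddCommGroup.primaryComponent (mordellCurve (D : ℚ)).sha 3) →
        (mordellCurve (D : ℚ)).ShaFinite)
    {D : ℤ} (hD : D ≠ 0) [(mordellCurve (D : ℚ)).IsGloballyMinimal]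
    (hrank : (mordellCurve (D : ℚ)).mordellWeilRank = 1)
    (hsha : Finite (AddCommGroup.primaryComponent (mordellCurve (D : ℚ)).sha 3)) :
    (mordellCurve (D : ℚ)).analyticRank = 1 :=
  analyticRank_eq_one_of_mordellWeilRank_eq_one_of_shaFinite_of_bko hBKO hD hrank
    (hprop hD hrank hsha)

end Summit.BirchSwinnertonDyer.BirchSwinnertonDyer.Theorems.MordellShaFreeCutOfFiniteSha

/-! ## Appendix (seat bsd-cn100-s2b-c3, same session): EVERY rational `D` and EVERY good prime
`p ≥ 5`, modulo the two refereed CM rank-one converses at good primes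

The rung reads `a_p` on a global minimal model, whence the restriction above to integral globally
minimal Mordell equations (some `E_D`, e.g. `27a`, have no globally minimal equation of Mordell
shape). For an arbitrary `D ∈ ℚ^×` one passes to a global minimal model `W' = C • E_D` (Néron;
tree theorem `hasGlobalMinimalModel_rat_holds`), which need not be a Mordell equation, and avoids
computing `a_p(W')` by granting BOTH refereed CM rank-one converses at a good prime `p ≥ 5` —
Burungale–Tian 2020 Thm. 1.2 (ordinary; tree fact
`burungaleTian_analyticRank_eq_one_of_selmerCorank_eq_one_of_hasCM`) and Burungale–Kobayashi–Ota
2024 Thm. 1.5 (supersingular) — combined in the tree theorem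
`BurungaleKobayashiOta2024.analyticRank_eq_one_of_mordellWeilRank_eq_one_of_finite_sha_primary_of_good`.
Every invariant in sight is transported along `C` by tree theorems (Mathlib `variableChange_j`;
`BSZLemma17.hasGoodReductionAtPrime_smul_iff`, `mordellWeilRank_variableChange_holds`,
`finite_primaryComponent_sha_variableChange`, `shaFinite_variableChange_iff_holds`,
`analyticRank_variableChange_holds`). OUTCOME (`…_of_good_prime`): the Ш-finite rank-one
`p`-converse for the Mordell family — the crux's statement with `3` replaced by `p` — holds at
EVERY prime `p ≥ 5` of good reduction of `E_D`, for every `D ∈ ℚ^×`, modulo those two refereed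
facts; the crux is the column `p = 3`, bad (additive, potentially supersingular) for every `D`. -/

namespace Summit.BirchSwinnertonDyer.BirchSwinnertonDyer.Theorems.MordellShaFreeCutOfFiniteSha

open Literature.NumberTheory.EllipticCurves WeierstrassCurve

/-- **Scaling a Mordell equation**: for `b ≠ 0`, the change of variables `u = b⁻¹` turns
`y² = x³ + D` into `y² = x³ + b⁶ D` (so every `E_D`, `D ∈ ℚ^×`, is `ℚ`-isomorphic to one with
integral parameter). [folklore] -/
theorem smul_mordellCurve_eq (D : ℚ) {b : ℚ} (hb : b ≠ 0) :
    (⟨(Units.mk0 b hb)⁻¹, 0, 0, 0⟩ : VariableChange ℚ) • mordellCurve D =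
      mordellCurve (b ^ 6 * D) := by
  ext
  · simp [variableChange_a₁, mordellCurve]
  · simp [variableChange_a₂, mordellCurve]
  · simp [variableChange_a₃, mordellCurve]
  · simp [variableChange_a₄, mordellCurve]
  · simp [variableChange_a₆, mordellCurve]

/-- **`E_D` (`D = n/d ∈ ℚ^×` in lowest terms) has good reduction at every prime `p ∤ 6 n d`**:
scale to the integral parameter `d⁵ n` (`smul_mordellCurve_eq`), use
`hasGoodReductionAtPrime_mordellCurve` (`p ∤ 6 d⁵ n`, Ireland–Rosen Ch. 18 §3 / Silverman VII.5.1(a))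
and the isomorphism invariance of good reduction (`BSZLemma17.hasGoodReductionAtPrime_smul_iff`).
[cite: SilvermanAEC2009, VII.5 Prop. 5.1 and VII.1 Prop. 1.3(b)] -/
theorem hasGoodReductionAtPrime_mordellCurve_rat {D : ℚ} {p : ℕ} [Fact p.Prime]
    (hp : ¬ (p : ℤ) ∣ 6 * D.num * D.den) : (mordellCurve D).HasGoodReductionAtPrime p := by
  have hpP : (p : ℕ).Prime := Fact.out
  have hpZ : Prime (p : ℤ) := Nat.prime_iff_prime_int.mp hpP
  have hden : (D.den : ℚ) ≠ 0 := by exact_mod_cast D.den_nz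
  set D' : ℤ := D.num * (D.den : ℤ) ^ 5 with hD'_def
  have hscale : ((D.den : ℚ)) ^ 6 * D = (D' : ℚ) := by
    have h := Rat.num_div_den D
    have h1 : ((D.den : ℚ)) ^ 6 * D = (D.den : ℚ) ^ 6 * ((D.num : ℚ) / D.den) := by rw [h]
    rw [h1, hD'_def]
    push_cast
    field_simp
  have hp6D : ¬ (p : ℤ) ∣ 6 * D' := by
    rw [hD'_def]
    intro h
    apply hp
    rw [← mul_assoc] at h
    rcases hpZ.dvd_or_dvd h with h6n | hd5
    · exact dvd_mul_of_dvd_left h6n _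
    · exact dvd_mul_of_dvd_right (hpZ.dvd_of_dvd_pow hd5) _
  have hgood : (mordellCurve (D' : ℚ)).HasGoodReductionAtPrime p :=
    hasGoodReductionAtPrime_mordellCurve hp6D
  rw [← hscale, ← smul_mordellCurve_eq D hden] at hgood
  exact (BSZLemma17.hasGoodReductionAtPrime_smul_iff _ _ p).1 hgood

/-- **A good prime `p ≥ 5` of `E_D`** (`D ∈ ℚ^×`): any prime beyond `max 5 (6 |n d| + 1)`
(Euclid, Mathlib `Nat.exists_infinite_primes`) with `hasGoodReductionAtPrime_mordellCurve_rat`.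
[folklore] -/
theorem exists_prime_five_le_hasGoodReductionAtPrime_mordellCurve {D : ℚ} (hD : D ≠ 0) :
    ∃ (p : ℕ) (_ : Fact p.Prime), 5 ≤ p ∧ (mordellCurve D).HasGoodReductionAtPrime p := by
  have hN0 : 6 * D.num * D.den ≠ 0 :=
    mul_ne_zero (mul_ne_zero (by norm_num) (Rat.num_ne_zero.mpr hD))
      (by exact_mod_cast D.den_nz)
  obtain ⟨p, hpge, hpP⟩ := Nat.exists_infinite_primes (max 5 ((6 * D.num * D.den).natAbs + 1))
  haveI : Fact p.Prime := ⟨hpP⟩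
  refine ⟨p, inferInstance, le_trans (le_max_left _ _) hpge,
    hasGoodReductionAtPrime_mordellCurve_rat ?_⟩
  intro h
  have h1 : p ∣ (6 * D.num * D.den).natAbs := Int.natCast_dvd.mp h
  have h3 := Nat.le_of_dvd (Int.natAbs_pos.mpr hN0) h1
  have h4 := le_trans (le_max_right _ _) hpge
  omega

/-- **The crux's statement with `3` replaced by ANY GOOD PRIME `p ≥ 5`, for EVERY `D ∈ ℚ^×`,
modulo the two refereed CM rank-one converses** — Burungale–Tian 2020 Thm. 1.2 (`hBT`, ordinary
`p ≥ 5`) and Burungale–Kobayashi–Ota 2024 Thm. 1.5 (`hBKO`, supersingular `p ≥ 5`): if `E_D` has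
good reduction at the prime `p ≥ 5`, then `rank E_D(ℚ) = 1 ∧ #Ш(E_D/ℚ)[p^∞] < ∞ ⟹
ord_{s=1} L(E_D, s) = 1`. Proof: a global minimal model `W' = C • E_D`
(`hasGlobalMinimalModel_rat_holds`) has CM (`j(W') = j(E_D) = 0`, `variableChange_j`,
`hasCM_of_j_eq_zero`), good reduction at `p`, rank `1` and finite `Ш[p^∞]` (transport theorems);
the tree's ordinary/supersingular dichotomy theorem
`analyticRank_eq_one_of_mordellWeilRank_eq_one_of_finite_sha_primary_of_good` applies to `W'`;
`ord_{s=1} L` is model-independent (`analyticRank_variableChange_holds`). So the Ш-finite rank-one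
converse for the Mordell family holds in print at every good prime `p ≥ 5`; the crux is the column
`p = 3` (additive, potentially supersingular, for every `D`).
[cite: BurungaleTian2019, Thm. 1.2 (p. 214)] [cite: BurungaleKobayashiOta2023, Thm. 1.5 (p. 1422)] -/
theorem analyticRank_eq_one_of_mordellWeilRank_eq_one_of_finite_sha_primary_of_good_prime
    (hBT : burungaleTian_analyticRank_eq_one_of_selmerCorank_eq_one_of_hasCM)
    (hBKO : BurungaleKobayashiOta2024.thm15_analyticRank_eq_one_of_selmerCorank_eq_one)
    {D : ℚ} (hD : D ≠ 0) (p : ℕ) [Fact p.Prime] (hp : 5 ≤ p)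
    (hgood : (mordellCurve D).HasGoodReductionAtPrime p)
    (hrank : (mordellCurve D).mordellWeilRank = 1)
    (hsha : Finite (AddCommGroup.primaryComponent (mordellCurve D).sha p)) :
    (mordellCurve D).analyticRank = 1 := by
  haveI := isElliptic_mordellCurve hD
  obtain ⟨C, hmin⟩ := hasGlobalMinimalModel_rat_holds (mordellCurve D)
  haveI : (C • mordellCurve D).IsGloballyMinimal := hmin
  have hCM : (C • mordellCurve D).HasCM :=
    hasCM_of_j_eq_zero _ (by
      rw [variableChange_j]; exact (mordellCurve D).j_eq_zero (mordellCurve_c₄ _))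
  have hgood' : (C • mordellCurve D).HasGoodReductionAtPrime p :=
    (BSZLemma17.hasGoodReductionAtPrime_smul_iff _ C p).2 hgood
  have hrank' : (C • mordellCurve D).mordellWeilRank = 1 := by
    rw [mordellWeilRank_variableChange_holds]; exact hrank
  haveI := hsha
  haveI : Finite (AddCommGroup.primaryComponent (C • mordellCurve D).sha p) :=
    WeierstrassCurve.finite_primaryComponent_sha_variableChange (mordellCurve D) C p
  have h := BurungaleKobayashiOta2024.analyticRank_eq_one_of_mordellWeilRank_eq_one_of_finite_sha_primary_of_good
    hBT hBKO (C • mordellCurve D) hCM p hp hgood' hrank' inferInstance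
  rwa [analyticRank_variableChange_holds (mordellCurve D) C] at h

/-- **Crux B with `Ш(E_D/ℚ)` finite in place of `Ш(E_D/ℚ)[3^∞]` finite, for EVERY `D ∈ ℚ^×`,
modulo `hBT` and `hBKO`**: `rank E_D(ℚ) = 1 ∧ #Ш(E_D/ℚ) < ∞ ⟹ ord_{s=1} L(E_D, s) = 1` — at a
good prime `p ≥ 5` of `E_D` (`exists_prime_five_le_hasGoodReductionAtPrime_mordellCurve`) the
`p`-primary part of the finite `Ш` is finite, and `…_of_good_prime` applies. This is the crux's
statement with the Ш-hypothesis moved off the `3`-primary part, over the crux's full range of `D`.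
[cite: BurungaleTian2019, Thm. 1.2 (p. 214)] [cite: BurungaleKobayashiOta2023, Thm. 1.5 (p. 1422)] -/
theorem analyticRank_eq_one_of_mordellWeilRank_eq_one_of_shaFinite_of_cmConverses
    (hBT : burungaleTian_analyticRank_eq_one_of_selmerCorank_eq_one_of_hasCM)
    (hBKO : BurungaleKobayashiOta2024.thm15_analyticRank_eq_one_of_selmerCorank_eq_one)
    {D : ℚ} (hD : D ≠ 0) (hrank : (mordellCurve D).mordellWeilRank = 1)
    (hsha : (mordellCurve D).ShaFinite) : (mordellCurve D).analyticRank = 1 := by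
  obtain ⟨p, _, hp5, hgood⟩ := exists_prime_five_le_hasGoodReductionAtPrime_mordellCurve hD
  haveI : Finite (mordellCurve D).sha := hsha
  exact analyticRank_eq_one_of_mordellWeilRank_eq_one_of_finite_sha_primary_of_good_prime hBT hBKO
    hD p hp5 hgood hrank inferInstance

/-- **The route decl with `Ш` in place of `Ш[3^∞]`, as a closed statement** (same binders as
`AnalyticRankOneOfRankOneFiniteShaThree`, the Ш-hypothesis strengthened), modulo `hBT`, `hBKO`. -/
theorem analyticRankOne_of_rankOne_of_shaFinite_of_cmConverses
    (hBT : burungaleTian_analyticRank_eq_one_of_selmerCorank_eq_one_of_hasCM)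
    (hBKO : BurungaleKobayashiOta2024.thm15_analyticRank_eq_one_of_selmerCorank_eq_one) :
    ∀ ⦃D : ℚ⦄, D ≠ 0 → (mordellCurve D).mordellWeilRank = 1 → (mordellCurve D).ShaFinite →
      (mordellCurve D).analyticRank = 1 :=
  fun _ hD hrank hsha ↦
    analyticRank_eq_one_of_mordellWeilRank_eq_one_of_shaFinite_of_cmConverses hBT hBKO hD hrank hsha

end Summit.BirchSwinnertonDyer.BirchSwinnertonDyer.Theorems.MordellShaFreeCutOfFiniteSha
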